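import Mathlib
import HarnessLib
import HarnessLib.Audit
import Summits.PneNP.Statement
import Literature.Computability.Complexity.Nondeterministic
import Literature.Computability.Complexity.BoolEncodings
import Literature.Computability.Complexity.GraphEncodings
import Literature.Computability.Complexity.TimeBounds
import HarnessLib.Audit.Status.Attr

/-!
Route: DirichletPigeons

DORMANT since 2026-08-22T23:34:17Z (reconciler: no traction for 5.7 d (last activity route-revised at 2026-08-17T04:51:32Z); parked, not closed — `ledger route dormant route-PneNP-DirichletPigeons --off` to reactivate) — unstaffed, not closed; items shared with open routes are served there. `ledger route dormant <id> --off` reactivates.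

# Route PneNP/DirichletPigeons — "Dirichlet's pigeons cannot be caught in subexponential time" (idea
card PneNP/PneNP/dirichlet-pigeons-dimension; widen: Diophantine approximation, geometry of numbers,
homogeneous dynamics)

## Thesis X (it suffices to show) — the price of a dimension for good simultaneous approximation
Words: there is δ > 0 such that Lagarias' GOOD SIMULTANEOUS APPROXIMATION problem GSA — instance α =
a/b ∈ ℚ^d, N ∈ ℕ, ε ∈ ℚ; question: is there 1 ≤ q ≤ N with ‖q·αᵢ‖ ≤ ε for every i (‖·‖ = distance to
the nearest integer) — is decided by NO deterministic Turing machine within c·2^{δ·d}·(L+1)^c steps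
(L = input length, d = the dimension field of the instance), whatever c. GSA is NP-complete when d
varies and in P for each fixed d [Lagarias1985]; a 2^{O(d)}·poly(L) algorithm exists (exact SVP_∞
sieving in dimension d+1 [BlomerNaewe2009, arXiv:1801.02358]), so X says "exactly single-exponential
in the dimension".
Lean (decl `GsaPriceOfDimension`, elaborates; rev 3): `∃ δ : ℝ, 0 < δ ∧ ¬ gsaInExpTime δ` with,
inlined by `let`, `gsaInExpTime δ := ∃ T : ℕ → ℕ → ℕ, expPoly δ T ∧ ∃ M,
Literature.Computability.Complexity.ComputesInTime encG Computability.encodeBool (fun I => decide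
(yes I)) (fun I => T I.1.1 (encG I).length) M`, `expPoly δ T := ∃ c : ℕ, ∀ n L, T n L ≤ c·2^{δ
n}·(L+1)^c` (verbatim the body of `Literature.Computability.FineGrained.IsExpPolyBound`), `I : (Σ d,
Fin d → ℤ) × ℕ × ℕ × ℚ` = (⟨d,a⟩, b, N, ε), `yes I := ∃ q, 1 ≤ q ∧ q ≤ N ∧ ∀ i, |q aᵢ/b − round(q
aᵢ/b)| ≤ ε`, and `encG` the code `boolPair (ivec I.1) (boolPair (encodeNat b) (boolPair (encodeNat
N) (code of (ε.num, ε.den))))`, `ivec := Encoding.sigmaBool (encodingFinVec encodingIntBool)`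
(Literature.Computability.Complexity.{BoolEncodings, GraphEncodings}). REV 3 (route-repair) changed
NO meaning: the statement is DEFINITIONALLY EQUAL (Iff.rfl, planner's Compare.lean rc 0) to the
rev-2 one written with `FineGrained.ComputesInTime`/`IsExpPolyBound` (`∃ M,
Complexity.ComputesInTime … M` is its body, `TimeBounds.exists_computesInTime_iff`) and
`EuclideanLattices.intVecEncoding.pairBool (encodingNatBool.pairBool (encodingNatBool.pairBool
encodingRatBool))` (unfolded); equivalently X ↔ `∃ δ > 0, ¬
Literature.NumberTheory.DiophantineApproximation.GSAInExpTime δ` of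
SimultaneousApproxComplexity.lean up to the choice-free `decide` (its
`gsaInExpTime_iff_of_indicator`). The constants are written out only so that the route's cone
carries no open conjecture (ETH, SETH, NPNotSubsetPPoly rode in on the FineGrainedWave0/ClayProblem
imports) and no mis-censused predicate (LatticeInstance.IsNonsingular).

## Assembly X → PneNP
`GsaMemNP → X → PneNP` (decl `Assembly`, rev 3; deciding theorem `closes : GsaPriceOfDimension →
GsaMemNP → Assembly → PneNP`, two applications): GSA ∈ NP (the denominator q is the certificate;
support item GsaMemNP); if ¬PneNP then every Wave0-NP language over Bool is in Wave0-P; the two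
PROVED model bridges `Literature.Computability.Complexity.P_bool_eq_holds` / `NP_bool_eq_holds`
(ClayProblem / ClayProblemProofs — used INSIDE the proof of the Assembly item, no longer hypotheses
of it, so that the open conjecture `NPNotSubsetPPoly` of ClayProblem.lean stays out of the route's
cone) turn GsaMemNP into `encG '' {yes} ∈ Classes.P`; `mem_P_iff_holds` gives a decider in time
p(|w|); on codewords the indicator is `decide (yes I)` (injectivity of the code), and T d L := p L
satisfies expPoly δ for every δ ≥ 0 (2^{δd} ≥ 1) — contradicting the δ of X (pattern of
`FineGrained.not_eth_of_P_eq_NP`). A candidate proof of the rev-2 Assembly (bridges as hypotheses)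
is on file (evidence of stmt-PneNP-3079, proof_DP_Assembly.lean, rc 0 against the real module); fed
with the two `_holds` it proves the rev-3 item verbatim (checked: Compare.lean).

## Two-layer plan (D-0019): cruxes first, glue later
C2 (rank 2) DirichletPriceOfDimension — the TOTAL pigeonhole problem DIRICHLET_d (given α = a/b ∈
ℚ^d and Q, output 1 ≤ q ≤ Q^d with ‖qαᵢ‖ < 1/Q ∀ i; a solution always exists) is not solvable in
2^{δd}·poly(L) for some δ > 0; glue C2 → X is the support item DirichletToGsa (search-to-decision:
binary search on N at ε = (⌈b/Q⌉−1)/b, dimension preserved). C3 (rank 3) MinkowskiToDirichlet —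
MINKOWSKI_∞ [SotirakiZampetakisZirdelis2018 §6] reduces to DIRICHLET with linear loss in the
dimension exponent. C4 (rank 4) BestApproximantAbundance — some α ∈ ℚ^d have ≥ c^d·log₂N best
simultaneous approximation denominators below N (c > 1 absolute), the unconditional rung against
every algorithm that enumerates best approximants (Lagarias-optimal multidimensional continued
fractions). Supports: SimultaneousDirichlet (pigeonhole, non-vacuity of C2), GsaMemNP,
DirichletToGsa, LllApproximateDirichlet (approximate Dirichlet IS in FP: LLL82 Prop. 1.39 on the
proved `lll_polyTime`). ETH ⇒ X (former support EthCalibration) is prose calibration since rev 3: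
`ETH` lives in FineGrainedWave0.lean next to the defs it needs and can only be imported together
with the open conjectures ETH/SETH, which no one can discharge; a cone-clean restatement over
Literature.Computability.Complexity.CNF is left to tenure. Splits, further glue and the
finite-memory MCF-transducer rung (needs definition MCFAlgorithm) are deliberately left to tenure.

Rationale: WHY THIS LINE (widen: Diophantine approximation + geometry of numbers + homogeneous dynamics;
realises card dirichlet-pigeons-dimension). The first theorem of Diophantine approximation is a
pigeonhole principle; the route reads P ≠ NP as "in dimension d the pigeons cost 2^{Ω(d)} to catch".
Two problems on one object α ∈ ℚ^d: the OPTIMAL one GSA (NP-complete, in P for fixed d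
[Lagarias1985]; approximating it is almost NP-hard [RossnerSeifert1996]) carries the thesis X; the
TOTAL one DIRICHLET_d (always solvable by Dirichlet 1842, in PPP via DIRICHLET ≤ MINKOWSKI ≤
BLICHFELDT [BanEtAl2019; SotirakiZampetakisZirdelis2018 §6, Lemma 6.1], PPP-hardness of MINKOWSKI =
their Open Problem 1.2) carries crux C2 — a lower bound for a total problem cannot come from
NP-hardness gadgets (TFNP) and is the genuinely open bet. X itself is a known CONDITIONAL statement:
Martin's deterministic, dimension- and (ℓ_∞-)gap-preserving reduction SVP → one GDA call on ℤ^n + xℤ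
[Martin2020, Alg. 4, Thm 4.7–4.8] composed with the SETH/gap-ETH hardness of SVP_∞/CVP_p
[BennettGolovnevStephensdavidowitz2017; AggarwalStephensdavidowitz2018] gives SETH ⇒ X; ETH ⇒ X with
linear dimension (prose calibration; the former support item EthCalibration was dropped at rev 3,
see TWO-LAYER PLAN in the thesis). The route's value is the native ladder of rungs and the
dictionary, not a claim that X is easier than the summit.
DICTIONARY (theorems, statement level): u_α = (1 α; 0 I_d), g_t = diag(e^{dt}, e^{−t}, …, e^{−t});
best simultaneous approximations of α ↔ shortest vectors of g_t u_α ℤ^{d+1} along the diagonal flow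
on SL_{d+1}(ℝ)/SL_{d+1}(ℤ) [Lagarias1994; Chevallier2005 p.5/Lemme 4]; Dirichlet ↔ Minkowski's
bound/Mahler compactness; divergent & bounded orbits ↔ singular & badly approximable α [Dani1985;
KleinbockMargulis1998]; and — the fact that defuses the card's "structure leak" worry — rational
points a/b of denominator b pushed to the critical time ARE Haar-equidistributed (d ≥ 2)
[EinsiedlerEtAl2015; duals = Goldstein–Mayer/Hecke lattices {y : a·y ≡ 0 mod b}: GoldsteinMayer2003,
StrombergssonVenkatesh2005, Marklof2010]: a uniformly random DIRICHLET_d instance, rescaled by g_t,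
is factor-2 Hermite-SVP_∞ on a Haar-random lattice of dimension d+1 — the regime every lattice
algorithm needs 2^{Θ(d)} for. d = 1 is the integrable point (Euclid/Gauss map codes the modular
geodesic flow and outputs every best approximant in polynomial time); for d ≥ 2 memoryless MCF maps
(Jacobi–Perron, Brun, Selmer) provably miss Dirichlet quality [Lagarias1993] and the one optimal MCF
(Lagarias' geodesic MCF) pays a lattice reduction per step.
RANKED CRUXES. #2 DirichletPriceOfDimension (hardest, most informative; total ⇒ no completeness
backstop; typed with `∃ M, Complexity.ComputesInTime … M` = FineGrained.ComputesInTime by Iff.rfl,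
output encodeNat). #3 MinkowskiToDirichlet (rev 3: MINKOWSKI_∞ instances typed `Σ n, Matrix (Fin n)
(Fin n) ℤ` with the bit format of LatticeInstance.encode (rfl), promise det ≠ 0 ∧ 1 ≤ n, output =
code of z in `encodingFinVec encodingIntBool n`; PPP-internal fine-grained hardness: ∃c ∀δ,
DIRICHLET ∈ TIME(2^{δd}poly) ⇒ MINKOWSKI_∞ ∈ TIME(2^{cδn}poly); converse of BJPPR's DIRICHLET ≤
MINKOWSKI; tools: HNF, Paz–Schnorr cyclic approximation, Martin's near-orthonormal sublattice trick,
the 2^{−poly} slack that integrality leaves in Minkowski's bound). #4 BestApproximantAbundance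
(native dynamics rung; Lagarias1982 gives #BSAD ≤ N = O(2^d log N) via liminf (1/m) ln q_m > 0
[Chevallier2005 p.8]; is the base-2-type exponential sharp? proof ⇒ every enumerator of best
approximants, in particular any optimal MCF, takes 2^{Ω(d)} steps; refutation ⇒ a new structural
bound on pigeons). Supports (rank 9): SimultaneousDirichlet, GsaMemNP, DirichletToGsa (glue C2 → X),
LllApproximateDirichlet (calibration on the PROVED
Literature.Algebra.EuclideanLattices.lll_polyTime: q ≤ 2^{⌈d(d+1)/4⌉}Q^d is free, the exact box is
the whole difficulty); informal: FiniteMemoryMcfRung (no finite-state transducer on a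
Brun/Jacobi–Perron digit stream outputs all best approximants for all α ∈ ℚ^d, d ≥ 2) pending
definition MCFAlgorithm.
#5 MinkowskiPriceOfDimension (stmt-PneNP-17627; the Minkowski floor the split of X rests on: ∃ δ >
0, no 2^{δn}·poly MINKOWSKI_∞ solver; summit-calibre like C2 but a different, total problem;
calibrated by the registered line sis_calibration: threshold SIS_∞ embeds dimension-preservingly, so
the floor follows from exponential worst-case security of SIS at the pigeonhole density). Supports
now also GsaThresholdSearch (stmt-PneNP-17628, glue of the split). KILL CRITERIA. A 2^{o(d)}·poly
algorithm for GSA refutes X and closes the route (it would also break SETH via Martin2020+ASD18, so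
it is not expected). A 2^{o(d)} algorithm for the TOTAL problem DIRICHLET_d refutes C2 only: the
route contracts to its NP-complete half (X, C3 moot, C4 alive) — record as pivot. C3 refuted
(provable non-reducibility is unlikely; more likely "exhausted") ⇒ replace by MINKOWSKI_∞-hardness
of a padded Dirichlet family. C4 refuted (#BSAD ≤ 2^{o(d)} log N uniformly) ⇒ keep as negative
knowledge; the enumeration rung dies, C2/C3 unaffected.
NOT DECOMPOSED YET. X IS NOW DECOMPOSED (crux-strategist 2026-08-17, BC2 redirect of the RESTATED
deciding crux): X ⇐ MinkowskiPriceOfDimension (stmt-PneNP-17627, crux rank 5: MINKOWSKI_∞ floor,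
C3's inline predicate verbatim) ∧ MinkowskiToDirichlet (C3) ∧ GsaThresholdSearch (stmt-PneNP-17628,
support: decision-to-search at the Dirichlet threshold), assembly PROVED against the route decls
(Cruxes/GsaPriceOfDimension/GsaPriceOfDimensionSplit.lean, theorem
dirichletPigeons_gsaPriceOfDimension_of_minkowski, 0 sorry; to be landed in Theorems/ by a prover)
through C2: Minkowski floor + C3 ⇒ C2 (exponent bookkeeping), C2 + threshold search ⇒ X (Dirichlet
pigeonhole, ‖k/b‖ < 1/Q ↔ ‖k/b‖ ≤ ⌊(b−1)/Q⌋/b, least-YES-bound minimality); piece probes Xi → PneNP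
/ Xi → X fail 3/3; registered skeleton lines sis_calibration (17627), hecke_normal_form (C3),
threshold_binary_search (17628) under Cruxes/GsaPriceOfDimension/Lines/. The `--split` verb itself
awaits the tenure planner / harness (SPLIT.md + SplitChildren.md in the crux directory give the
exact command with --glue-by). Still not decomposed: C2 directly (it is now DERIVED from 17627 +
C3), C4; no PPP/TFNP classes (DIRICHLET ∈ PPP stays prose); no BKZ/block-reduction rung, no
branching-proof rung, no MCF classes until MCFAlgorithm lands; no ℓ_p variants; no quantum side.
CHEAPEST FALSIFIER. For X and C2 at once: a deterministic 2^{o(d)}·poly(L) algorithm for DIRICHLET_d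
on the structured slice b = Q^{d+1} (pure cube, co-cyclic Construction-A lattice bℤ^{d+1} + (1,a)ℤ)
— the one place a 'structure leak' is plausible; it refutes C2 and, through DirichletToGsa, nothing
else (X survives, being SETH-hard). For C4: count sup-norm best-approximation denominators ≤ N in d
= 2…6 for diagonal golden-ratio vectors and random a/b (refuter g40-37 ran this, BestApproxProbe.md:
no growth in d beyond ≈ 1.44·log₂N) — this cannot refute an ∃α statement but says the extremal
construction is the whole content; a proof of #BSAD ≤ 2^{o(d)}·log N for all α refutes C4. For C3:
none cheap (needs a subexponential DIRICHLET solver formalised AND a Minkowski floor); its cheap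
sanity check — non-vacuity of the Minkowski clause for n ≥ 1 — is Minkowski's convex-body theorem
(Mathlib), done by the route reviewers.
SOURCES: Lagarias1985, Lagarias1982, Lagarias1993, Lagarias1994, RossnerSeifert1996, BanEtAl2019,
SotirakiZampetakisZirdelis2018 (=arXiv:1808.06407), Martin2020 (=arXiv:2003.12173),
BennettGolovnevStephensdavidowitz2017, AggarwalStephensdavidowitz2018, BlomerNaewe2009,
arXiv:1801.02358, LenstraLenstraLovasz1982, EinsiedlerEtAl2015, GoldsteinMayer2003,
StrombergssonVenkatesh2005, Marklof2010, Dani1985, KleinbockMargulis1998, Chevallier2005,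
ImpagliazzoPaturiJCSS2001.

Novelty: Nearest prior art (searched before claiming) and delta. THESIS X is NOT claimed new: Martin2020 (=
arXiv:2003.12173, read: Def 1.2, Alg. 4, Thm 4.7–4.8; dimension- and ℓ_∞-gap-preserving SVP → one
GDA call on ℤ^n + xℤ) composed with the SETH/gap-ETH hardness of SVP_∞/CVP_p
(BennettGolovnevStephensdavidowitz2017; AggarwalStephensdavidowitz2018 = arXiv:1712.00942) makes
"2^{Ω(d)} for GSA" a known conditional statement (variant); Lagarias1985 supplies
NP-completeness/fixed-d P, RossnerSeifert1996 inapproximability. NEW IN COMBINATION: (i) crux C2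
bets 2^{Ω(d)} on the TOTAL pigeonhole problem DIRICHLET_d — in PPP by BanEtAl2019 /
SotirakiZampetakisZirdelis2018 (= arXiv:1808.06407, read: p.5, §6 Lemma 6.1, Open Problem 1.2),
where NP-hardness cannot be the mechanism — typed in the tree's fine-grained time model; (ii) crux
C3, the fine-grained converse MINKOWSKI_∞ ≤ DIRICHLET of BJPPR's reduction, not found posed; (iii)
crux C4, sharpness of Lagarias1982's 2^d spacing law as an abundance statement whose proof is an
unconditional 2^{Ω(d)} bound for every enumerator of best approximants (optimal multidimensional
continued fractions; Lagarias1993, Lagarias1994; Chevallier2005 = doi:10.5802/aif.2134, read, p.8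
records only the adjacent open question on lim (1/m) ln q_m), not found posed; (iv) the dictionary
fact that uniformly random DIRICHLET_d instances pushed along the diagonal flow are factor-2
Hermite-SVP_∞ instances on Haar-random lattices (EinsiedlerEtAl2015; GoldsteinMayer2003,  [refs: 10.5802/aif.2134, 10.1137/0214016, 10.2307/1998713, 2003.12173, 1712.00942, 1808.06407, 2209.07625, doi:10.5802/aif.2134, doi:10.1137/0214016, doi:10.2307/1998713, Martin2020, BennettGolovnevStephensdavidowitz2017, AggarwalStephensdavidowitz2018, Lagarias1985, RossnerSeifert1996, BanEtAl2019, SotirakiZampetakisZirdelis2018, Lagarias1982, Lagarias1993, Lagarias1994, Chevallier2005, EinsiedlerEtAl20]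

Barriers (technique_class: geometry-of-numbers, homogeneous-dynamics, total-search): - Literature.Barriers.PneNP.LatticeGapCoNP : governs NP-hardness of APPROXIMATE GapSVP/GapCVP at
factors ≥ c√n; not engaged — GSA is used at its exact NP-complete threshold (Lagarias1985) and
DIRICHLET at Dirichlet's exact constant; moreover C2/C3 concern TOTAL problems, for which many-one
NP-hardness is not even the intended mechanism (a TFNP problem NP-hard under Karp reductions gives
NP = coNP), so the barrier's lesson is built in: C2 must be a direct lower bound, C3 a reduction
between total problems.
- Literature.Barriers.PneNP.Relativization : applies at thesis level — X ⇒ PneNP through the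
Assembly (GSA ∈ NP + Wave0 bridges), so a proof of X or of C2 composes to a proof of the summit and
cannot relativize. Not evaded; the bet is that the rungs (C3: an explicit arithmetic reduction; C4:
counting best approximants; MCF-class failures) are oracle-free statements about explicit rational
vectors and lattices, and that the homogeneous-dynamics information (non-divergence,
equidistribution of rational horosphere points, orbit-coding entropy in rank d) is specific to THIS
language; no mechanism from rungs to all Turing machines is claimed.
- Literature.Barriers.PneNP.BoundedRelativization : same status as Relativization (binds the
thesis-level step X ⇒ PneNP, silent on C3/C4).
- Literature.Barriers.PneNP.Algebrization : same status — any proof of X must be non-algebrizing;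
the arithmetic/dynamical rungs are outside its technique class, the thesis-level step is not evaded.
- Li

Novelty grade: new-combination — refuter route-review gen-1 (rreview-39f6b731). This route was fully reviewed by gen-0 (rreview-77be3272, 12:07–12:12Z) and stamped by refuter pools g40/g41 (12:52–12:55Z); I CONCUR and add only deltas. (1) C3 3081: I independently re-found and re-proved the n=0 junk collapse (MinkowskiToDirichlet ↔  (refuter refuter-rreview-route-AtomisticToContinu-39f6b731-0, 2026-08-15T13:52:59Z; prior: arXiv:2003.12173 (Martin2020 Alg.4, Thm 4.7-4.8), arXiv:1712.00942 (AggarwalStephensdavidowitz2018), BennettGolovnevStephensdavidowitz2017, doi:10.1137/0214016 (Lagarias1985), arXiv:1808.06407 (SZZ18 §6, OP 1.2), doi:10.1090/s0002-9947-1982-0662052-7 (Lagarias1982 I, acq-02310), doi:10.2140/pjm.1982.102.61 (Lagarias1982 II, read), arXiv:1906.11173 (Cheung–Chevallier 2024))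

History (route lifecycle, newest last):
- 2026-08-15T11:14:25Z · rev 2: dropped stmt-PneNP-3117 — drop duplicate: stmt-PneNP-3117 is the same informal FiniteMemoryMcfRung item as stmt-PneNP-3197 (filed twice by a CLI retry); 3197 is kept and carries defn-MCF (planner-plancard-PneNP-PneNP-dirichlet-pigeon-a2629a7e-0)
- 2026-08-15T16:26:34Z · rev 3: restated GsaPriceOfDimension (stmt-PneNP-3078), DirichletPriceOfDimension (stmt-PneNP-3080), MinkowskiToDirichlet (stmt-PneNP-3081), GsaMemNP (stmt-PneNP-3084), DirichletToGsa (stmt-PneNP-3085), LllApproximateDirichlet (stmt-PneNP-3086), Assembly (stmt-PneNP-3079) — route-repair rev 3 (rbadge-PneNP-DirichletPige (planner-rbadge-PneNP-DirichletPigeons-54ff1508-g2-0)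
- 2026-08-15T16:26:34Z · rev 3: dropped EthCalibration — route-repair rev 3 (rbadge-PneNP-DirichletPigeons-54ff1508-g2, glue + cone): (1) GLUE — deciding theorem `closes : GsaPriceOfDimension → GsaMemNP → Assembly → P (planner-rbadge-PneNP-DirichletPigeons-54ff1508-g2-0)
- 2026-08-16T04:13:58Z · AUTO-CRUX (backfill): GsaPriceOfDimension — hypotheses of the deciding theorem that nothing in the route derives are cruxes (operator:999:1085951)
- 2026-08-22T23:34:17Z · DORMANT — reconciler: no traction for 5.7 d (last activity route-revised at 2026-08-17T04:51:32Z); parked, not closed — `ledger route dormant route-PneNP-DirichletPigeons (operator:999:3741375)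

sub-problem: PneNP · status: dormant · opened planner-plancard-PneNP-PneNP-dirichlet-pigeon-a2629a7e-0 2026-08-15T11:10:56Z · rev 6 · ledger route-PneNP-DirichletPigeons
GENERATED by the gate from the ledger (D-0016/17). Provers cite these decls: `theorem foo : Summit.PneNP.PneNP.Theses.DirichletPigeons.<Decl> := …` in Summits/PneNP/PneNP/Theorems/<Name>.lean.
-/

namespace Summit.PneNP.PneNP.Theses.DirichletPigeons

open scoped BigOperators Topology Manifold Classical MeasureTheory ProbabilityTheory Matrix InnerProductSpace ComplexConjugate ContinuousMap
open Filter Set Function TopologicalSpace MeasureTheory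

attribute [summit_statement] _root_.PneNP

open Literature.PNP

-- earlier GsaPriceOfDimension (stmt-PneNP-3078, replaced 2026-08-15T16:26:34Z -> stmt-PneNP-10856): retired by None — let dn : ℚ → ℚ := fun x => |x - ((round x : ℤ) : ℚ)|; let enc := Literature.Algebra.EuclideanLattices.intVecEncoding.pairBool (_root_.Computability.encodingNatBool.pairBool (_root_.Computability.encodingNatBool.pairBool Literature.Algebra.EuclideanLattices.encodingRatBool)); let yes 
/-- item stmt-PneNP-10856 · crux (kind.auto-crux: conjecture-grade) · rank 0 · open · by planner
why it might fail: SETH-calibre and X ⇒ P≠NP: known only conditionally (SETH/Gap-ETH ⇒ X via Martin2020 Alg.4 + ASD18/BGS17; unconditional 2^{Ω(n)} bounds for SVP/CVP exist under no hypothesis, Bennett2023 §2.3, OP 4.12); no relativizing/algebrizing proof can reach it; a 2^{o(d)}·poly GSA algorithm refutes it.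
sources: Lagarias1985, Martin2020, arXiv:2003.12173, AggarwalStephensdavidowitz2018, BennettGolovnevStephensdavidowitz2017, doi:10.1145/3586165.3586172
[target] Thesis X — the price of a dimension: for some δ > 0, Lagarias' GOOD SIMULTANEOUS
APPROXIMATION (I = (⟨d,a⟩, b, N, ε) : (Σ d, Fin d → ℤ) × ℕ × ℕ × ℚ, α = a/b ∈ ℚ^d; YES iff some 1 ≤
q ≤ N has ‖q αᵢ‖ = |q aᵢ/b − round(q aᵢ/b)| ≤ ε ∀ i) is decided by no deterministic FinTM2 within
c·2^{δd}·(L+1)^c steps, any c (model `∃ M, Complexity.ComputesInTime … M` + inlined expPoly δ T := ∃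
c ∀ n L, T n L ≤ c·2^{δn}(L+1)^c — DEFINITIONALLY FineGrained.ComputesInTime/IsExpPolyBound;
parameter d; code = the intVecEncoding.pairBool (encodingNatBool.pairBool (encodingNatBool.pairBool
encodingRatBool)) bits written over BoolEncodings/GraphEncodings =
SimultaneousApproxInstance.encoding of SimultaneousApproxComplexity.lean, whose GSAInExpTime δ is
gsaInExpTime δ up to the choice-free decide). Rev 3 = rev 2 by Iff.rfl. NP-complete for varying d,
in P for fixed d [Lagarias1985]; 2^{O(d)}·poly upper bound by deterministic exact SVP_∞/CVP_∞ in
dimension d+1 (Dadush–Peikert–Vempala 2011) — X says 'exactly single-exponential'. KNOWN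
CONDITIONALLY: SETH ⇒ X (Martin2020 Alg. 4 + ASD18/BGS17); ETH ⇒ X likewise (prose; item
EthCalibration dropped rev 3). X ⇒ PneNP = GsaMemNP + Assembly (`closes`). -/
@[route_item "route-PneNP-DirichletPigeons", crux]
def GsaPriceOfDimension : Prop :=
  let dn : ℚ → ℚ := fun x => |x - ((round x : ℤ) : ℚ)|; let ivec : Computability.Encoding (Σ n : ℕ, Fin n → ℤ) Bool := Computability.Encoding.sigmaBool fun n => Literature.Computability.Complexity.encodingFinVec Literature.Computability.Complexity.encodingIntBool n; let encG : ((Σ d : ℕ, Fin d → ℤ) × ℕ × ℕ × ℚ) → List Bool := fun I => Literature.Computability.Complexity.boolPair (ivec.encode I.1) (Literature.Computability.Complexity.boolPair (Computability.encodeNat I.2.1) (Literature.Computability.Complexity.boolPair (Computability.encodeNat I.2.2.1) ((Literature.Computability.Complexity.encodingIntBool.pairBool Computability.encodingNatBool).encode (I.2.2.2.num, I.2.2.2.den)))); let yes : ((Σ d : ℕ, Fin d → ℤ) × ℕ × ℕ × ℚ) → Prop := fun I => ∃ q : ℕ, 1 ≤ q ∧ q ≤ I.2.2.1 ∧ ∀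 i : Fin I.1.1, dn ((q : ℚ) * I.1.2 i / I.2.1) ≤ I.2.2.2; let expPoly : ℝ → (ℕ → ℕ → ℕ) → Prop := fun δ T => ∃ c : ℕ, ∀ n L : ℕ, (T n L : ℝ) ≤ c * (2 : ℝ) ^ (δ * n) * ((L : ℝ) + 1) ^ c; let gsaInExpTime : ℝ → Prop := fun δ => ∃ T : ℕ → ℕ → ℕ, expPoly δ T ∧ ∃ M, Literature.Computability.Complexity.ComputesInTime encG Computability.encodeBool (fun I => decide (yes I)) (fun I => T I.1.1 (encG I).length) M; ∃ δ : ℝ, 0 < δ ∧ ¬ gsaInExpTime δ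

-- earlier DirichletPriceOfDimension (stmt-PneNP-3080, replaced 2026-08-15T16:26:34Z -> stmt-PneNP-10861): retired by None — let dn : ℚ → ℚ := fun x => |x - ((round x : ℤ) : ℚ)|; let enc := Literature.Algebra.EuclideanLattices.intVecEncoding.pairBool (_root_.Computability.encodingNatBool.pairBool _root_.Computability.encodingNatBool); let sol : ((Σ d : ℕ, Fin d → ℤ) × ℕ × ℕ) → ℕ → Prop := fun J q => 
/-- item stmt-PneNP-10861 · crux · rank 2 · open · by planner
why it might fail: May be false on THIS slice (lattices bℤ^{d+1}+(1,a)ℤ, one box at the pigeonhole threshold): totality (DIRICHLET ≤ MINKOWSKI ∈ PPP, BanEtAl2019) bars NP- /SETH-hardness evidence, MINKOWSKI's PPP-hardness is open (SZZ18 OP 1.2); a 2^{o(d)}·poly algorithm refutes it; a proof is an FP≠TFNP bound ⇒ P≠NP.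
sources: BanEtAl2019, SotirakiZampetakisZirdelis2018, arXiv:1808.06407, doi:10.1145/3586165.3586172, EinsiedlerEtAl2015, GoldsteinMayer2003
[crux] C2 — DIRICHLET_d, the TOTAL pigeonhole problem, costs 2^{Ω(d)}. Instance J = (⟨d,a⟩, b, Q), α
= a/b ∈ ℚ^d, valid iff 1 ≤ b, 1 ≤ Q; solution 1 ≤ q ≤ Q^d with ‖q αᵢ‖ < 1/Q ∀ i — always exists
(pigeonhole; support SimultaneousDirichlet; Literature DirichletInstance.exists_isSolution);
DIRICHLET ≤ MINKOWSKI ≤ BLICHFELDT ∈ PPP [BanEtAl2019; SZZ18 §6; PPP-hardness of MINKOWSKI = OP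
1.2]. Claim: ∃ δ > 0, no f solving every valid instance (output encodeNat q) is computed in time
c·2^{δd}·(L+1)^c (model as in X; rev 3 = rev 2 by Iff.rfl; = `∃ δ > 0, ¬ DirichletInExpTime δ` of
SimultaneousApproxComplexity definitionally). Upper bound 2^{O(d)}·poly (exact box search in
dimension d+1, DPV 2011); trivial if Q^d ≥ b. Why THE crux: totality removes every completeness
backstop — a proof is a direct lower bound; the 'structure leak' worry is defused: random instances
(a mod b) rescaled by diag(Q^{-d}, Q, …, Q) are factor-2 Hermite-SVP_∞ instances on Haar-random
lattices of dimension d+1 [EinsiedlerEtAl2015; Hecke-lattice duals: GoldsteinMayer2003,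
Marklof2010], where lattice algorithms take 2^{Θ(d)}. Glue C2 → X = DirichletToGsa; a 2^{o(d)}
algorithm here contracts the route to X. -/
@[route_item "route-PneNP-DirichletPigeons"]
def DirichletPriceOfDimension : Prop :=
  let dn : ℚ → ℚ := fun x => |x - ((round x : ℤ) : ℚ)|; let ivec : Computability.Encoding (Σ n : ℕ, Fin n → ℤ) Bool := Computability.Encoding.sigmaBool fun n => Literature.Computability.Complexity.encodingFinVec Literature.Computability.Complexity.encodingIntBool n; let encD : ((Σ d : ℕ, Fin d → ℤ) × ℕ × ℕ) → List Bool := (ivec.pairBool (Computability.encodingNatBool.pairBool Computability.encodingNatBool)).encode; let solD : ((Σ d : ℕ, Fin d → ℤ) × ℕ × ℕ) → ℕ → Prop := fun J q => 1 ≤ q ∧ q ≤ J.2.2 ^ J.1.1 ∧ ∀ i : Fin J.1.1, dn ((q : ℚ) * J.1.2 i / J.2.1) < 1 / (J.2.2 : ℚ); let expPoly : ℝ → (ℕ → ℕ → ℕ) → Prop := fun δ T => ∃ c : ℕ, ∀ n L : ℕ, (T n L : ℝ) ≤ c * (2 : ℝ) ^ (δ * n) * ((L : ℝ) + 1) ^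 c; ∃ δ : ℝ, 0 < δ ∧ ∀ f : ((Σ d : ℕ, Fin d → ℤ) × ℕ × ℕ) → ℕ, (∀ J, 1 ≤ J.2.1 → 1 ≤ J.2.2 → solD J (f J)) → ¬ ∃ T : ℕ → ℕ → ℕ, expPoly δ T ∧ ∃ M, Literature.Computability.Complexity.ComputesInTime encD Computability.encodeNat f (fun J => T J.1.1 (encD J).length) M

-- earlier MinkowskiToDirichlet (stmt-PneNP-3081, replaced 2026-08-15T16:26:34Z -> stmt-PneNP-10862): retired by None — let dn : ℚ → ℚ := fun x => |x - ((round x : ℤ) : ℚ)|; let encD := Literature.Algebra.EuclideanLattices.intVecEncoding.pairBool (_root_.Computability.encodingNatBool.pairBool _root_.Computability.encodingNatBool); let solD : ((Σ d : ℕ, Fin d → ℤ) × ℕ × ℕ) → ℕ → Prop := fun J q => 1 ≤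
/-- item stmt-PneNP-10862 · crux · rank 3 · open · by planner
why it might fail: Real content = a fine-grained reduction MINKOWSKI_∞ ≤ DIRICHLET (only the converse is known, BanEtAl2019; SVP_∞→GDA: Martin2020); false iff the Dirichlet slice has 2^{o(d)} algorithms while threshold Minkowski_∞ keeps a 2^{Ω(n)} floor; exact cube→Dirichlet-box embedding may need n↦ω(n), breaking cδ.
sources: BanEtAl2019, SotirakiZampetakisZirdelis2018, arXiv:1808.06407, Martin2020, arXiv:2003.12173, doi:10.1145/3586165.3586172
[crux] C3 — MINKOWSKI_∞ reduces to DIRICHLET with linear loss in the dimension exponent. MINKOWSKI_∞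
(SZZ18 §6): input B ∈ ℤ^{n×n}, det B ≠ 0, n ≥ 1 (typed `Σ n, Matrix (Fin n) (Fin n) ℤ` =
LatticeInstance via equivSigma, input code = LatticeInstance.encode bit-for-bit (rfl); n ≥ 1
excludes the empty instance, nonsingular but unsolvable), output z ≠ 0 with |(zB)_j|^n ≤ |det B| ∀
j, i.e. ‖zB‖_∞ ≤ det(L)^{1/n} (total: Minkowski; in PPP; hardness = OP 1.2), written as the code of
z in `encodingFinVec encodingIntBool n` (malformed ⇒ junk 0, no solution). Claim (algorithmic): ∃ c
> 0 ∀ δ > 0, DIRICHLET ∈ TIME(2^{δd}·poly) → MINKOWSKI_∞ ∈ TIME(2^{cδn}·poly). CONVERSE of BJPPR's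
DIRICHLET ≤ MINKOWSKI [BanEtAl2019]; optimisation analogue = Martin2020 Alg. 4 (SVP_∞ → one GDA
call). Tools: HNF, Paz–Schnorr, Martin's sublattice trick, reshaping the cube into a Dirichlet box
(b = Q^{d+1}), the slack ⌊det^{1/n}⌋ vs det^{1/n}. Content lives in the ¬C2 world (g41: C2 + a
2^{O(n)} Minkowski solver give the typed form); use = MinkowskiFloor ∧ C3 ⇒ C2. Rev 3 re-typed it
off LatticeInstance (the mis-censused predicate IsNonsingular leaves the cone); DIRICHLET side
definitionally as in C2. -/
@[route_item "route-PneNP-DirichletPigeons"]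
def MinkowskiToDirichlet : Prop :=
  let dn : ℚ → ℚ := fun x => |x - ((round x : ℤ) : ℚ)|; let ivec : Computability.Encoding (Σ n : ℕ, Fin n → ℤ) Bool := Computability.Encoding.sigmaBool fun n => Literature.Computability.Complexity.encodingFinVec Literature.Computability.Complexity.encodingIntBool n; let encD : ((Σ d : ℕ, Fin d → ℤ) × ℕ × ℕ) → List Bool := (ivec.pairBool (Computability.encodingNatBool.pairBool Computability.encodingNatBool)).encode; let solD : ((Σ d : ℕ, Fin d → ℤ) × ℕ × ℕ) → ℕ → Prop := fun J q => 1 ≤ q ∧ q ≤ J.2.2 ^ J.1.1 ∧ ∀ i : Fin J.1.1, dn ((q : ℚ) * J.1.2 i / J.2.1) < 1 / (J.2.2 : ℚ); let expPoly : ℝ → (ℕ → ℕ → ℕ) → Prop := fun δ T => ∃ c : ℕ, ∀ n L : ℕ, (T n L : ℝ) ≤ c * (2 : ℝ) ^ (δ * n) * ((L : ℝ) + 1) ^ c; let dirichletInExpTime : ℝ → Prop := fun δ => ∃ f : ((Σ d : ℕ, Fin d → ℤ) × ℕ × ℕ) → ℕ, (∀ J, 1 ≤ J.2.1 → 1 ≤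 J.2.2 → solD J (f J)) ∧ ∃ T : ℕ → ℕ → ℕ, expPoly δ T ∧ ∃ M, Literature.Computability.Complexity.ComputesInTime encD Computability.encodeNat f (fun J => T J.1.1 (encD J).length) M; let imat : Computability.Encoding (Σ n : ℕ, Matrix (Fin n) (Fin n) ℤ) Bool := Computability.Encoding.sigmaBool fun n => (Literature.Computability.Complexity.encodingFinVec Literature.Computability.Complexity.encodingIntBool (n * n)).ofEquiv (Matrix.of.symm.trans ((Equiv.curry (Fin n) (Fin n) ℤ).symm.trans (finProdFinEquiv.arrowCongr (Equiv.refl ℤ)))); let solM : (B : (Σ n : ℕ, Matrix (Fin n) (Fin n) ℤ)) → (Fin B.1 → ℤ) → Prop := fun B z => z ≠ 0 ∧ ∀ j : Fin B.1, |Matrix.vecMul z B.2 j| ^ B.1 ≤ |B.2.det|; let minkowskiInExpTime : ℝ → Prop := fun δ => ∃ g : (Σ n : ℕ, Matrix (Fin n) (Fin n) ℤ) → List Bool, (∀ B : (Σ n : ℕ, Matrix (Fin n) (Fin n) ℤ), B.2.det ≠ 0 → 1 ≤ B.1 → solM B (((Literature.Computability.Complexity.encodingFinVec Literature.Computability.Complexity.encodingIntBool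 B.1).decode (g B)).getD 0)) ∧ ∃ T : ℕ → ℕ → ℕ, expPoly δ T ∧ ∃ M, Literature.Computability.Complexity.ComputesInTime imat.encode (id : List Bool → List Bool) g (fun B => T B.1 (imat.encode B).length) M; ∃ c : ℝ, 0 < c ∧ ∀ δ : ℝ, 0 < δ → dirichletInExpTime δ → minkowskiInExpTime (c * δ)

/-- item stmt-PneNP-3082 · crux · rank 4 · open · by planner
why it might fail: Truth may be 2^{o(d)}·log N: a.e. α: (1/n)ln q_n → L_d>0 (ℓ₂: CheungChevallier2024 Thm 1; sup norm asked there), so O_d(log N) records; records in a dyadic range need distinct sign patterns (Lagarias1982, h=2^{d+1}) plus additive constraints (q_k−q_j+q_l) that may force 2^{o(d)}; only c≈1.44 known.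
sources: Lagarias1982, Chevallier2005, doi:10.5802/aif.2134, doi:10.24033/asens.2573, arXiv:1906.11173, book:young2007-surveys-geometry-number-theory-reports-contemporary-russian
[crux] C4 — abundance of best simultaneous approximants (the native dynamics rung). q ≥ 1 is a best
simultaneous approximation denominator (BSAD) of α = a/b ∈ ℚ^d if every 1 ≤ q' < q has max_i ‖q' αᵢ‖
> max_i ‖q αᵢ‖ (typed: ∃ i ∀ j, ‖q α_j‖ < ‖q' α_i‖). Lagarias1982: liminf (1/m) ln q_m > 0 uniformly
in α (spacing of type q_{m+2^{d+1}} ≥ 2 q_m; Chevallier2005 p.8), so #BSAD ≤ N = O(2^d · log N).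
Claim: sharp up to the base — ∃ c > 1 ∀ d ≥ 2, for arbitrarily large N some α ∈ ℚ^d has ≥ c^d · log₂
N BSADs in [1, N]. Proof ⇒ every algorithm printing all best approximants up to N (Lagarias'
geodesic MCF [Lagarias1994], any 'optimal' multidimensional continued fraction) takes 2^{Ω(d)} steps
on some inputs — an unconditional rung; flow dictionary: orbit segments of g_t u_α ℤ^{d+1} with
exponentially many systole switches per unit time (near-critical lattices whose many near-minimal
vectors take turns). Refutation (#BSAD ≤ 2^{o(d)} · log N for all α) is an equally informative
structural theorem and kills only the enumeration rung. Calibration: d = 1 golden-ratio-type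
rationals give ≈ 1.44 · log₂ N convergents (c ≤ 1.44); generic α have ≈ ln N sup-norm records. -/
@[route_item "route-PneNP-DirichletPigeons"]
def BestApproximantAbundance : Prop :=
  let dn : ℚ → ℚ := fun x => |x - ((round x : ℤ) : ℚ)|; ∃ c : ℝ, 1 < c ∧ ∀ d : ℕ, 2 ≤ d → ∀ N₀ : ℕ, ∃ N : ℕ, N₀ ≤ N ∧ ∃ (b : ℕ) (a : Fin d → ℤ), c ^ d * Real.logb 2 N ≤ (((Finset.Icc 1 N).filter (fun q : ℕ => ∀ q' ∈ Finset.Ico (1 : ℕ) q, ∃ i : Fin d, ∀ j : Fin d, dn ((q : ℚ) * a j / b) < dn ((q' : ℚ) * a i / b))).card : ℝ)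

/-- item stmt-PneNP-17627 · crux · rank 5 · open · by planner
why it might fail: A 2^{Ω(n)} bound for a TOTAL (PPP) problem against all TMs is an FP≠TFNP-type separation ⇒ P≠NP: summit-calibre, no known technique; totality bars SETH/NP-hardness evidence (a Cook-NP-hard TFNP problem gives NP = coNP); a 2^{o(n)}·poly MINKOWSKI_∞ solver refutes it.
sources: SotirakiZampetakisZirdelis2018, arXiv:1808.06407, BanEtAl2019, AggarwalStephensdavidowitz2018, BennettGolovnevStephensdavidowitz2017, doi:10.1145/3586165.3586172
[crux] [crux — split piece 1 of GsaPriceOfDimension (X); the statement the route header anticipated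
under NOT DECOMPOSED YET] MINKOWSKI_∞ FLOOR — the price of a dimension for Minkowski's convex-body
theorem: there is δ > 0 such that NO g solving MINKOWSKI_∞ (SZZ18 §6: input a nonsingular B ∈
ℤ^{n×n}, n ≥ 1, typed `Σ n, Matrix (Fin n) (Fin n) ℤ` in the LatticeInstance bit format; output z ≠
0 with |(zB)_j|^n ≤ |det B| ∀ j, i.e. ‖zB‖_∞ ≤ det^{1/n}, written as the code of z in
`encodingFinVec encodingIntBool n`, junk ⇒ no solution; TOTAL by Minkowski, in PPP) is computed
within c·2^{δn}·(L+1)^c for any c — `∃ δ > 0, ¬ minkowskiInExpTime δ` with C3's inline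
`minkowskiInExpTime` VERBATIM, so that MinkowskiPriceOfDimension → MinkowskiToDirichlet →
DirichletPriceOfDimension (C2) is pure exponent bookkeeping (δ₀ = c·δ₁; proved, planner
SplitProof.lean). Upper bound 2^{O(n)}·poly (deterministic exact SVP_∞/CVP_∞). Registered line
`sis-calibration` (Cruxes/GsaPriceOfDimension/Lines/sis-calibration.lean): threshold SIS_∞ (A ∈
ℤ_q^{n×m}, q^n < 2^m, find z ∈ {−1,0,1}^m∖0 with Az ≡ 0) embeds into MINKOWSKI_∞ on the q-ary kernel
lattice (det ≤ q^n < 2^m ⇒ Minkowski solutions have sup-norm ≤ 1; Aj -/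
@[route_item "route-PneNP-DirichletPigeons"]
def MinkowskiPriceOfDimension : Prop :=
  let expPoly : ℝ → (ℕ → ℕ → ℕ) → Prop := fun δ T => ∃ c : ℕ, ∀ n L : ℕ, (T n L : ℝ) ≤ c * (2 : ℝ) ^ (δ * n) * ((L : ℝ) + 1) ^ c; let imat : Computability.Encoding (Σ n : ℕ, Matrix (Fin n) (Fin n) ℤ) Bool := Computability.Encoding.sigmaBool fun n => (Literature.Computability.Complexity.encodingFinVec Literature.Computability.Complexity.encodingIntBool (n * n)).ofEquiv (Matrix.of.symm.trans ((Equiv.curry (Fin n) (Fin n) ℤ).symm.trans (finProdFinEquiv.arrowCongr (Equiv.refl ℤ)))); let solM : (B : (Σ n : ℕ, Matrix (Fin n) (Fin n) ℤ)) → (Fin B.1 → ℤ) → Prop := fun B z => z ≠ 0 ∧ ∀ j : Fin B.1, |Matrix.vecMul z B.2 j| ^ B.1 ≤ |B.2.det|; let minkowskiInExpTime : ℝ → Prop := fun δ => ∃ g : (Σ n : ℕ, Matrix (Fin n) (Fin n) ℤ) → List Bool, (∀ B : (Σ n : ℕ, Matrix (Fin n) (Fin n) ℤ), B.2.det ≠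 0 → 1 ≤ B.1 → solM B (((Literature.Computability.Complexity.encodingFinVec Literature.Computability.Complexity.encodingIntBool B.1).decode (g B)).getD 0)) ∧ ∃ T : ℕ → ℕ → ℕ, expPoly δ T ∧ ∃ M, Literature.Computability.Complexity.ComputesInTime imat.encode (id : List Bool → List Bool) g (fun B => T B.1 (imat.encode B).length) M; ∃ δ : ℝ, 0 < δ ∧ ¬ minkowskiInExpTime δ

-- earlier GsaMemNP (stmt-PneNP-3084, replaced 2026-08-15T16:26:34Z -> stmt-PneNP-10863): retired by None — let dn : ℚ → ℚ := fun x => |x - ((round x : ℤ) : ℚ)|; let enc := Literature.Algebra.EuclideanLattices.intVecEncoding.pairBool (_root_.Computability.encodingNatBool.pairBool (_root_.Computability.encodingNatBool.pairBool Literature.Algebra.EuclideanLattices.encodingRatBool)); let yes : ((Σ d : ℕ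
/-- item stmt-PneNP-10863 · support · rank 9 · closed · proved by Summit.PneNP.PneNP.Theorems.dirichletPigeons_gsaMemNP_proof @ a8d31f51c93c (prover) · by planner
sources: Lagarias1985
[support] GSA ∈ NP (Nondeterministic.NP = polyExists Classes.P): certificate y = encodeNat q with q
≤ N, so |y| ≤ |x|; typed `encG '' {I | yes I} ∈ Nondeterministic.NP` (= enc.toLanguage {yes}, rfl);
the checking language {boolPair (encG I) (encodeNat q) | 1 ≤ q ≤ N ∧ ∀ i, |q aᵢ/b − round(q aᵢ/b)| ≤
ε} is in P (decode the instance, d multiplications and reductions mod b, rational comparisons;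
reject non-codewords). Needed by the Assembly; same shape as the Lattice route's 'GapSVP_n ∈
PromiseNP' item; the trivial half of Lagarias1985's NP-completeness. [rev 3, route-repair: constants
written over the clean cone Literature.Computability.Complexity.{TimeBounds, BoolEncodings,
GraphEncodings, Nondeterministic}; statement DEFINITIONALLY EQUAL to rev 2 (Iff.rfl, Compare.lean rc
0): `∃ M, Complexity.ComputesInTime … M` is the body of FineGrained.ComputesInTime, `expPoly` the
body of IsExpPolyBound, the codes are the EuclideanLattices.intVecEncoding/encodingRatBool
composites unfolded.] -/
@[route_item "route-PneNP-DirichletPigeons", crux]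
def GsaMemNP : Prop :=
  let dn : ℚ → ℚ := fun x => |x - ((round x : ℤ) : ℚ)|; let ivec : Computability.Encoding (Σ n : ℕ, Fin n → ℤ) Bool := Computability.Encoding.sigmaBool fun n => Literature.Computability.Complexity.encodingFinVec Literature.Computability.Complexity.encodingIntBool n; let encG : ((Σ d : ℕ, Fin d → ℤ) × ℕ × ℕ × ℚ) → List Bool := fun I => Literature.Computability.Complexity.boolPair (ivec.encode I.1) (Literature.Computability.Complexity.boolPair (Computability.encodeNat I.2.1) (Literature.Computability.Complexity.boolPair (Computability.encodeNat I.2.2.1) ((Literature.Computability.Complexity.encodingIntBool.pairBool Computability.encodingNatBool).encode (I.2.2.2.num, I.2.2.2.den)))); let yes : ((Σ d : ℕ, Fin d → ℤ) × ℕ × ℕ × ℚ) → Prop := fun I => ∃ q : ℕ, 1 ≤ q ∧ q ≤ I.2.2.1 ∧ ∀ i : Fin I.1.1, dn ((q : ℚ) * I.1.2 i / I.2.1) ≤ I.2.2.2; encG '' {I | yes I} ∈ Literature.Computability.Complexity.Nondeterministic.NP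

-- earlier DirichletToGsa (stmt-PneNP-3085, replaced 2026-08-15T16:26:34Z -> stmt-PneNP-10864): retired by None — let dn : ℚ → ℚ := fun x => |x - ((round x : ℤ) : ℚ)|; let encG := Literature.Algebra.EuclideanLattices.intVecEncoding.pairBool (_root_.Computability.encodingNatBool.pairBool (_root_.Computability.encodingNatBool.pairBool Literature.Algebra.EuclideanLattices.encodingRatBool)); let yes : ((
/-- item stmt-PneNP-10864 · support · rank 9 · open · by planner
sources: Lagarias1985, Literature.Computability.Complexity.SearchToDecision
[support, glue C2 → X] If GSA is decidable in time 2^{δd}·poly for every δ > 0 then DIRICHLET_d is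
solvable in time 2^{δd}·poly for every δ > 0 (hence DirichletPriceOfDimension → GsaPriceOfDimension;
checked from the two signatures in the planner's Sketch.lean). Proof: distances ‖q aᵢ/b‖ are
multiples of 1/b, so '< 1/Q' iff '≤ ε := (⌈b/Q⌉ − 1)/b'; binary-search the least N ∈ [1, Q^d] with
GSA(a, b, N, ε) = YES — it exists by SimultaneousDirichlet and is itself a solution (monotone in N)
— with d·log₂ Q ≤ L² adaptive calls on instances of dimension d and length poly(L). TM plumbing: a
loop around a sub-machine (cf. Literature/Computability/Complexity/SearchToDecision.lean). [rev 3,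
route-repair: constants written over the clean cone Literature.Computability.Complexity.{TimeBounds,
BoolEncodings, GraphEncodings, Nondeterministic}; statement DEFINITIONALLY EQUAL to rev 2 (Iff.rfl,
Compare.lean rc 0): `∃ M, Complexity.ComputesInTime … M` is the body of FineGrained.ComputesInTime,
`expPoly` the body of IsExpPolyBound, the codes are the
EuclideanLattices.intVecEncoding/encodingRatBool composites unfolded.] -/
@[route_item "route-PneNP-DirichletPigeons"]
def DirichletToGsa : Prop :=
  let dn : ℚ → ℚ := fun x => |x - ((round x : ℤ) : ℚ)|; let ivec : Computability.Encoding (Σ n : ℕ, Fin n → ℤ) Bool := Computability.Encoding.sigmaBool fun n => Literature.Computability.Complexity.encodingFinVec Literature.Computability.Complexity.encodingIntBool n; let encG : ((Σ d : ℕ, Fin d → ℤ) × ℕ × ℕ × ℚ) → List Bool := fun I => Literature.Computability.Complexity.boolPair (ivec.encode I.1) (Literature.Computability.Complexity.boolPair (Computability.encodeNat I.2.1) (Literature.Computability.Complexity.boolPair (Computability.encodeNat I.2.2.1) ((Literature.Computability.Complexity.encodingIntBool.pairBool Computability.encodingNatBool).encode (I.2.2.2.num, I.2.2.2.den)))); let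 yes : ((Σ d : ℕ, Fin d → ℤ) × ℕ × ℕ × ℚ) → Prop := fun I => ∃ q : ℕ, 1 ≤ q ∧ q ≤ I.2.2.1 ∧ ∀ i : Fin I.1.1, dn ((q : ℚ) * I.1.2 i / I.2.1) ≤ I.2.2.2; let expPoly : ℝ → (ℕ → ℕ → ℕ) → Prop := fun δ T => ∃ c : ℕ, ∀ n L : ℕ, (T n L : ℝ) ≤ c * (2 : ℝ) ^ (δ * n) * ((L : ℝ) + 1) ^ c; let gsaInExpTime : ℝ → Prop := fun δ => ∃ T : ℕ → ℕ → ℕ, expPoly δ T ∧ ∃ M, Literature.Computability.Complexity.ComputesInTime encG Computability.encodeBool (fun I => decide (yes I)) (fun I => T I.1.1 (encG I).length) M; let encD : ((Σ d : ℕ, Fin d → ℤ) × ℕ × ℕ) → List Bool := (ivec.pairBool (Computability.encodingNatBool.pairBool Computability.encodingNatBool)).encode; let solD : ((Σ d : ℕ, Fin d → ℤ) × ℕ × ℕ) → ℕ → Prop := fun J q => 1 ≤ q ∧ q ≤ J.2.2 ^ J.1.1 ∧ ∀ i : Fin J.1.1, dn ((q : ℚ) * J.1.2 i / J.2.1) <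 1 / (J.2.2 : ℚ); let dirichletInExpTime : ℝ → Prop := fun δ => ∃ f : ((Σ d : ℕ, Fin d → ℤ) × ℕ × ℕ) → ℕ, (∀ J, 1 ≤ J.2.1 → 1 ≤ J.2.2 → solD J (f J)) ∧ ∃ T : ℕ → ℕ → ℕ, expPoly δ T ∧ ∃ M, Literature.Computability.Complexity.ComputesInTime encD Computability.encodeNat f (fun J => T J.1.1 (encD J).length) M; (∀ δ : ℝ, 0 < δ → gsaInExpTime δ) → ∀ δ : ℝ, 0 < δ → dirichletInExpTime δ

-- earlier LllApproximateDirichlet (stmt-PneNP-3086, replaced 2026-08-15T16:26:34Z -> stmt-PneNP-10865): retired by None — let dn : ℚ → ℚ := fun x => |x - ((round x : ℤ) : ℚ)|; let enc := Literature.Algebra.EuclideanLattices.intVecEncoding.pairBool (_root_.Computability.encodingNatBool.pairBool _root_.Computability.encodingNatBool); ∃ f : ((Σ d : ℕ, Fin d → ℤ) × ℕ × ℕ) → ℕ, (∀ J, 1 ≤ J.2.1 → 1 ≤ J.2.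
/-- item stmt-PneNP-10865 · support · rank 9 · closed · proved by Summit.PneNP.PneNP.Theorems.dirichletPigeons_lllApproximateDirichlet_proof @ fb0afb18a5c4 (prover) · by planner
sources: LenstraLenstraLovasz1982, Literature.Algebra.EuclideanLattices.lll_polyTime_holds
[support, calibration] APPROXIMATE Dirichlet is in FP: a polynomial-time f (PolyTimeComputable,
output encodeNat) with 1 ≤ f(J) ≤ 2^{⌈d(d+1)/4⌉}·Q^d and ‖f(J)·aᵢ/b‖ ≤ 1/Q ∀ i on valid instances —
LLL82 Prop. 1.39 with ε = 1/Q: LLL-reduce the (d+1)-dimensional lattice spanned by e₁, …, e_d and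
(−α, 2^{−d(d+1)/4} ε^{d+1}); the first reduced vector has all coordinates ≤ ε in absolute value,
giving |pᵢ − q αᵢ| ≤ ε and 1 ≤ q ≤ 2^{d(d+1)/4} ε^{−d} (Q = 1 trivial; clear denominators for an
integer lattice basis). Rests on the PROVED fact Literature.Algebra.EuclideanLattices.lll_polyTime
(lll_polyTime_holds) and the LLL82 Prop. 1.6–1.12 bounds discharged in PQCLLLProofs
(norm_zero_le_covolume_rpow). Calibration for C2: the factor 2^{O(d²)} in q is what polynomial time
buys; the exact box q ≤ Q^d is the whole difficulty. [rev 3: `encD` written over the clean cone,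
statement definitionally equal to rev 2 (Iff.rfl).] -/
@[route_item "route-PneNP-DirichletPigeons"]
def LllApproximateDirichlet : Prop :=
  let dn : ℚ → ℚ := fun x => |x - ((round x : ℤ) : ℚ)|; let ivec : Computability.Encoding (Σ n : ℕ, Fin n → ℤ) Bool := Computability.Encoding.sigmaBool fun n => Literature.Computability.Complexity.encodingFinVec Literature.Computability.Complexity.encodingIntBool n; let encD : ((Σ d : ℕ, Fin d → ℤ) × ℕ × ℕ) → List Bool := (ivec.pairBool (Computability.encodingNatBool.pairBool Computability.encodingNatBool)).encode; ∃ f : ((Σ d : ℕ, Fin d → ℤ) × ℕ × ℕ) → ℕ, (∀ J, 1 ≤ J.2.1 → 1 ≤ J.2.2 → 1 ≤ f J ∧ f J ≤ 2 ^ ((J.1.1 * (J.1.1 + 1) + 3) / 4) * J.2.2 ^ J.1.1 ∧ ∀ i : Fin J.1.1, dn ((f J : ℚ) * J.1.2 i / J.2.1) ≤ 1 / (J.2.2 : ℚ)) ∧ Literature.Computability.Complexity.PolyTimeComputable encD Computability.encodeNat f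

/-- item stmt-PneNP-17628 · support · rank 9 · open · by planner
[support] [support — split piece 3 of GsaPriceOfDimension: decision-to-search at the Dirichlet
threshold, dimension AND exponent preserved] For every δ > 0: if GSA is decided within
c·2^{δd}·(L+1)^c (X's inline gsaInExpTime δ verbatim) then some g, computed within
c'·2^{δd}·(L+1)^{c'} on the DIRICHLET code encD (output encodeNat), returns on every valid DIRICHLET
instance J = (⟨d,a⟩, b, Q) (1 ≤ b, 1 ≤ Q) whose threshold problem has a YES bound N ≤ Q^d the LEAST
N with GSA(a, b, N, ε(b,Q)) = YES, ε(b,Q) = ⌊(b−1)/Q⌋/b (`leastYes J N`: 1 ≤ N ≤ Q^d, YES at N, NO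
at every 1 ≤ N' < N). Proof: `yes` is monotone in N; binary search over N ∈ [1, Q^d] with ≤ d·log₂Q
+ 1 ≤ L + 1 adaptive calls of the GSA machine on re-encoded instances (a, b, N, ε(b,Q)) of the SAME
dimension and length O(L); TM plumbing = a loop around a sub-machine (pattern of
Literature/Computability/Complexity/SearchToDecision.lean). Registered line
`threshold-binary-search` (stub_thresholdOfGsa = oracle recoding, stub_searchOfThreshold = binary
search). Differs from DirichletToGsa (stmt-PneNP-10864: ∀δ hypothesis, outputs a DIRICHLET solver)
by being per-δ and returning the least threshold — the form the split's glue cons -/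
@[route_item "route-PneNP-DirichletPigeons"]
def GsaThresholdSearch : Prop :=
  let dn : ℚ → ℚ := fun x => |x - ((round x : ℤ) : ℚ)|; let ivec : Computability.Encoding (Σ n : ℕ, Fin n → ℤ) Bool := Computability.Encoding.sigmaBool fun n => Literature.Computability.Complexity.encodingFinVec Literature.Computability.Complexity.encodingIntBool n; let encG : ((Σ d : ℕ, Fin d → ℤ) × ℕ × ℕ × ℚ) → List Bool := fun I => Literature.Computability.Complexity.boolPair (ivec.encode I.1) (Literature.Computability.Complexity.boolPair (Computability.encodeNat I.2.1) (Literature.Computability.Complexity.boolPair (Computability.encodeNat I.2.2.1) ((Literature.Computability.Complexity.encodingIntBool.pairBool Computability.encodingNatBool).encode (I.2.2.2.num, I.2.2.2.den)))); let yes : ((Σ d : ℕ, Fin d → ℤ) × ℕ × ℕ × ℚ) → Prop := fun I => ∃ q : ℕ, 1 ≤ q ∧ q ≤ I.2.2.1 ∧ ∀ i : Fin I.1.1, dn ((q : ℚ) * I.1.2 i / I.2.1) ≤ I.2.2.2; let expPoly : ℝ → (ℕ → ℕ → ℕ) → Prop := fun δ T => ∃ c : ℕ, ∀ n L : ℕ,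 (T n L : ℝ) ≤ c * (2 : ℝ) ^ (δ * n) * ((L : ℝ) + 1) ^ c; let gsaInExpTime : ℝ → Prop := fun δ => ∃ T : ℕ → ℕ → ℕ, expPoly δ T ∧ ∃ M, Literature.Computability.Complexity.ComputesInTime encG Computability.encodeBool (fun I => decide (yes I)) (fun I => T I.1.1 (encG I).length) M; let encD : ((Σ d : ℕ, Fin d → ℤ) × ℕ × ℕ) → List Bool := (ivec.pairBool (Computability.encodingNatBool.pairBool Computability.encodingNatBool)).encode; let epsD : ((Σ d : ℕ, Fin d → ℤ) × ℕ × ℕ) → ℚ := fun J => ((((J.2.1 - 1) / J.2.2 : ℕ)) : ℚ) / (J.2.1 : ℚ); let leastYes : ((Σ d : ℕ, Fin d → ℤ) × ℕ × ℕ) → ℕ → Prop := fun J N => 1 ≤ N ∧ N ≤ J.2.2 ^ J.1.1 ∧ yes (J.1, J.2.1, N, epsD J) ∧ ∀ N' : ℕ, 1 ≤ N' → N' < N → ¬ yes (J.1, J.2.1, N', epsD J); ∀ δ : ℝ, 0 < δ → gsaInExpTime δ → ∃ g : ((Σ d : ℕ, Fin d → ℤ) × ℕ × ℕ) → ℕ,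 (∀ J : (Σ d : ℕ, Fin d → ℤ) × ℕ × ℕ, 1 ≤ J.2.1 → 1 ≤ J.2.2 → (∃ N : ℕ, 1 ≤ N ∧ N ≤ J.2.2 ^ J.1.1 ∧ yes (J.1, J.2.1, N, epsD J)) → leastYes J (g J)) ∧ ∃ T : ℕ → ℕ → ℕ, expPoly δ T ∧ ∃ M, Literature.Computability.Complexity.ComputesInTime encD Computability.encodeNat g (fun J => T J.1.1 (encD J).length) M

/-- item stmt-PneNP-3083 · support · rank 9 · closed · proved by Summit.PneNP.PneNP.Theorems.dirichletPigeons_simultaneousDirichlet_proof @ 439f8d323bb6 (prover) · by planner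
sources: Lagarias1985, Mathlib:Real.exists_int_int_abs_mul_sub_le
[support] Dirichlet's simultaneous approximation theorem in exactly the form used by C2: for all d,
a ∈ ℤ^d, b and Q ≥ 1 there is 1 ≤ q ≤ Q^d with |q aᵢ/b − round(q aᵢ/b)| < 1/Q for every i
(pigeonhole: the Q^d + 1 points ({q aᵢ/b})ᵢ, 0 ≤ q ≤ Q^d, in Q^d boxes of side 1/Q; two in one box
differ by the wanted q; Mathlib Fintype.exists_ne_map_eq_of_card_lt, abs_sub_round; d = 0, b = 0, Q
= 1 trivial). Makes C2 non-vacuous (a correct f exists); provable now. -/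
@[route_item "route-PneNP-DirichletPigeons"]
def SimultaneousDirichlet : Prop :=
  let dn : ℚ → ℚ := fun x => |x - ((round x : ℤ) : ℚ)|; ∀ (d : ℕ) (a : Fin d → ℤ) (b Q : ℕ), 1 ≤ Q → ∃ q : ℕ, 1 ≤ q ∧ q ≤ Q ^ d ∧ ∀ i : Fin d, dn ((q : ℚ) * a i / b) < 1 / (Q : ℚ)

-- item stmt-PneNP-3197 · support · rank 9 · open · by planner — informal only, no Lean statement yet:
--   [support → crux-candidate; informal until the definition MCFAlgorithm lands, then set-signature +
--   retriage to crux rank 5] FINITE-MEMORY MCF RUNG (the card's R2, first genuinely new rung of the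
--   ladder; R1 = memoryless maps is known): for every d ≥ 2, every memoryless piecewise-unimodular
--   multidimensional continued fraction map T on the d-simplex with finitely many polyhedral pieces
--   (Jacobi–Perron, Brun, Selmer, … in the framework of Schweiger 2000 / Lagarias1993 §2) and every
--   finite-state transducer M reading the digit stream of T(α) and emitting, at each step, a subset of
--   the entries of the c

-- earlier Assembly (stmt-PneNP-3079, replaced 2026-08-15T16:26:34Z -> stmt-PneNP-10866): retired by None — let dn : ℚ → ℚ := fun x => |x - ((round x : ℤ) : ℚ)|; let enc := Literature.Algebra.EuclideanLattices.intVecEncoding.pairBool (_root_.Computability.encodingNatBool.pairBool (_root_.Computability.encodingNatBool.pairBool Literature.Algebra.EuclideanLattices.encodingRatBool)); let yes : ((Σ d : ℕ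
/-- item stmt-PneNP-10866 · assembly · rank 1 · closed · proved by Summit.PneNP.PneNP.Theorems.dirichletPigeons_assembly_proof @ 9e46c88ea2b9 (prover) · by planner
sources: Literature.Computability.Complexity.P_bool_eq_holds, Literature.Computability.Complexity.NP_bool_eq_holds, Literature.Computability.FineGrained.not_eth_of_P_eq_NP, ImpagliazzoPaturiJCSS2001
[assembly] GsaMemNP → GsaPriceOfDimension → PneNP (rev 3; deciding theorem `closes hX hNP hA := hA
hNP hX`). The rev-2 form carried the model bridges P_bool_eq, NP_bool_eq as hypotheses; both are
PROVED (P_bool_eq_holds, ClayProblem.lean; NP_bool_eq_holds, ClayProblemProofs.lean) and now belong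
INSIDE the proof, keeping ClayProblem.lean (home of the open conjecture NPNotSubsetPPoly) out of the
route's cone. PROVABLE NOW: the rev-2 candidate proof proof_DP_Assembly.lean (evidence on
stmt-PneNP-3079, rc 0 against the real module, standard axioms) fed with the two `_holds` proves
this item verbatim (checked, route-repair Compare.lean); land it as
Theorems/DirichletPigeonsAssembly.lean importing ClayProblemProofs. Plan: ¬PneNP ⇒ Wave0-NP ⊆
Wave0-P; bridges ⇒ `encG '' {yes} ∈ Classes.P`; mem_P_iff_holds ⇒ decider in time p(|w|); on
codewords the indicator is `decide (yes I)` (Encoding.mem_toLanguage_iff); T d L := p L is expPoly δ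
for all δ ≥ 0 (2^{δd} ≥ 1; pattern FineGrained.not_eth_of_P_eq_NP) — contradicting the δ of X. -/
@[route_item "route-PneNP-DirichletPigeons", crux]
def Assembly : Prop :=
  GsaMemNP → GsaPriceOfDimension → _root_.PneNP

/-! D-0027 §2.1 — DECIDING THEOREM (planner-authored via `route open/edit --closes-file`; by planner-rbadge-PneNP-DirichletPigeons-54ff1508-g2-0 2026-08-15T16:26:34Z):
its hypotheses are this route's items and its conclusion the sub-problem Statement (glue_lint), and it elaborates with this file. -/

@[closes "route-PneNP-DirichletPigeons"] theorem closes (hX : GsaPriceOfDimension) (hNP : GsaMemNP) (hA : Assembly) : _root_.PneNP :=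
  hA hNP hX

end Summit.PneNP.PneNP.Theses.DirichletPigeons
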